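import Literature.NumberTheory.Rogawski1990.AdelicStableOrbitalIntegral
import HarnessLib

/-!
# Signed versus unsigned pre-stabilisation totals: `Φ^{e}(γ, f) + Φ^{e·κ}(γ, f) = Φ^{st}(γ, f) + Φ^{κ}(γ, f)` when `e ≡ 1` on the `κ`-trivial classes
(Rogawski, *Automorphic Representations of Unitary Groups in Three Variables* (1990), §4.1 (4.1.2) pp. 39–40, §4.3 p. 44, §5.4 (5.4.1)–(5.4.3) pp. 72–73,
§14.5 p. 239; Kottwitz, *Stable trace formula: elliptic singular terms*, Math. Ann. 275 (1986), §9)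

Topic `NumberTheory/Rogawski1990`; namespace `Literature.NumberTheory.Rogawski1990`; THEOREMS ONLY (no definition, no instance, no notation, no named
fact, no `sorry`), GENERIC in the group `Γ` and in the weights.  Cell hodgecm-mathlib, FLOOR-0 programme P3a, row O7 (T1b at the non-regular classes),
RULING #116 (W19 «Kottwitz signs»): at a singular class the stable ∕ κ orbital sums carry the Kottwitz sign `e(δ) = ±1`, while the ★ pre-stabilisation
COUNT (`Σ_{rational δ} Φ(δ) = ½(Φ^{1}(γ₀) + Φ^{κ}(γ₀))`, ★ `PreStabilisationSingularSelf` ∕ `StableClassOrbitalSumToAdelicSemisimple`) is sign-free.  The two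
are reconciled CLASS BY CLASS: `e(δ)·(1 + κ(obs δ)) = 1 + κ(obs δ)`, because either `κ(obs δ) = −1` (both sides vanish) or `obs δ = 0`, in which case `δ`
is rational (Hasse) and `e(δ) = ∏_v e_v(δ_v) = 1` (product formula).  Here that bookkeeping is typed for ABSTRACT weights `E`, `W`, `W′` on the classes
(`W′ = E·W` on `𝒞`, and on every class of `𝒞` either `W = −1` or `E = 1`), under the finite-support hypothesis the consumers already carry; the T1b-NONREG
closer (v5, signed currency) turns the ★ unsigned count `hD1` into the signed split it reads.  HC_CM is proved only modulo the printed citations until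
rung 0 closes.

* `adelicKappaOrbitalSum_eq_sum_support` — the `κ`-sum as a `Finset` sum over the support finset of the class integrals (any weight).
* **`adelicKappaOrbitalSum_add_eq_of_forall`** — `Φ^{E} + Φ^{W′} = Φ^{st} + Φ^{W}` for `W′ = E·W` on `𝒞` and `W = −1 ∨ E = 1` class by class.
* **`half_adelicKappaOrbitalSum_add_eq_of_forall`** — the `½`-form: the signed pre-stabilisation split equals the unsigned one.

## References
* J. D. Rogawski, *Automorphic Representations of Unitary Groups in Three Variables*, Ann. of Math. Stud. 123 (1990), §4.1 pp. 39–40, §4.3 p. 44,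
  §5.4 pp. 72–73, §14.5 p. 239 [Rogawski1990].
* R. E. Kottwitz, *Stable trace formula: elliptic singular terms*, Math. Ann. 275 (1986), 365–399, §9 [Kottwitz1986].
-/

set_option autoImplicit false

noncomputable section

open Function

namespace Literature.NumberTheory.Rogawski1990

open Literature.NumberTheory.Automorphic

section SignedTotals

variable {Γ : Type*} [Group Γ] [∀ g : Γ, MeasurableSpace (Γ ⧸ Subgroup.centralizer ({g} : Set Γ))]
  (𝒞 : Set (ConjClasses Γ)) (m : OrbitalMeasureFamily Γ)

/-- **Finite-support form of the `κ`-sum**: if only finitely many classes of `𝒞` have a non-zero orbital integral, `Φ^{w}(𝒞, f)` is the `Finset`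
sum over them (ANY weight `w`; companion of ★ `adelicStableOrbitalSum_eq_sum`). [cite: Rogawski1990, §4.3 p. 44; §5.4 (5.4.3) pp. 72–73] -/
theorem adelicKappaOrbitalSum_eq_sum_support (w : ConjClasses Γ → ℂ) (f : Γ → ℂ)
    (h : (𝒞 ∩ support fun c => classOrbitalIntegral m f c).Finite) :
    adelicKappaOrbitalSum 𝒞 w m f = ∑ c ∈ h.toFinset, w c * classOrbitalIntegral m f c := by
  refine finsum_mem_eq_sum_of_subset _ (fun c hc => ?_) (fun c hc => ?_)
  · obtain ⟨h𝒞, hs⟩ := hc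
    have hne : classOrbitalIntegral m f c ≠ 0 := fun h0 => hs (by simp only [h0, mul_zero])
    exact h.mem_toFinset.2 ⟨h𝒞, hne⟩
  · exact (h.mem_toFinset.1 hc).1

/-- **SIGNED TOTAL = UNSIGNED TOTAL**: for weights `E`, `W`, `W′` on the classes with `W′ = E · W` on `𝒞` and, class by class on `𝒞`, `W = −1` or `E = 1`
(print: `E = e` the Kottwitz sign, `W = κ ∘ obs`; `obs δ = 0` forces `δ` rational by the Hasse principle and then `e(δ) = 1` by the product formula),
`Φ^{E}(𝒞, f) + Φ^{W′}(𝒞, f) = Φ^{st}(𝒞, f) + Φ^{W}(𝒞, f)` — termwise `E·(1 + W) = 1 + W`. [cite: Rogawski1990, §4.1 (4.1.2) pp. 39–40; §5.4 (5.4.1)–(5.4.3) pp. 72–73;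
§14.5 p. 239] [cite: Kottwitz1986, §9] -/
theorem adelicKappaOrbitalSum_add_eq_of_forall (f : Γ → ℂ) {E W W' : ConjClasses Γ → ℂ}
    (hfin : (𝒞 ∩ support fun c => classOrbitalIntegral m f c).Finite)
    (hW' : ∀ c ∈ 𝒞, W' c = E c * W c) (hEW : ∀ c ∈ 𝒞, W c = -1 ∨ E c = 1) :
    adelicKappaOrbitalSum 𝒞 E m f + adelicKappaOrbitalSum 𝒞 W' m f =
      adelicStableOrbitalSum 𝒞 m f + adelicKappaOrbitalSum 𝒞 W m f := by
  rw [adelicKappaOrbitalSum_eq_sum_support 𝒞 m E f hfin, adelicKappaOrbitalSum_eq_sum_support 𝒞 m W' f hfin,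
    adelicKappaOrbitalSum_eq_sum_support 𝒞 m W f hfin, adelicStableOrbitalSum_eq_sum 𝒞 m f hfin, ← Finset.sum_add_distrib,
    ← Finset.sum_add_distrib]
  refine Finset.sum_congr rfl fun c hc => ?_
  have hc𝒞 : c ∈ 𝒞 := (hfin.mem_toFinset.1 hc).1
  rw [hW' c hc𝒞]
  rcases hEW c hc𝒞 with hW | hE
  · rw [hW]; ring
  · rw [hE]; ring

/-- **The signed pre-stabilisation split equals the unsigned one**: under the same hypotheses,
`½ · (Φ^{E}(𝒞, f) + Φ^{W′}(𝒞, f)) = ½ · (Φ^{st}(𝒞, f) + Φ^{W}(𝒞, f))` — so the ★ sign-free count `Σ_{rational δ} Φ(δ) = ½(Φ^{st} + Φ^{κ})` delivers the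
signed split `½(Φ^{e} + Φ^{e·κ})` the stabilised identity reads [§14.5 p. 239]. [cite: Rogawski1990, §5.4 (5.4.1)–(5.4.3) pp. 72–73; §14.5 p. 239]
[cite: Kottwitz1986, §9] -/
theorem half_adelicKappaOrbitalSum_add_eq_of_forall (f : Γ → ℂ) {E W W' : ConjClasses Γ → ℂ}
    (hfin : (𝒞 ∩ support fun c => classOrbitalIntegral m f c).Finite)
    (hW' : ∀ c ∈ 𝒞, W' c = E c * W c) (hEW : ∀ c ∈ 𝒞, W c = -1 ∨ E c = 1) :
    (1 / 2 : ℂ) * (adelicKappaOrbitalSum 𝒞 E m f + adelicKappaOrbitalSum 𝒞 W' m f) =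
      (1 / 2 : ℂ) * (adelicStableOrbitalSum 𝒞 m f + adelicKappaOrbitalSum 𝒞 W m f) := by
  rw [adelicKappaOrbitalSum_add_eq_of_forall 𝒞 m f hfin hW' hEW]

end SignedTotals

end Literature.NumberTheory.Rogawski1990

end
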